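import Summits.HubbardSuperconductivity.HubbardSuperconductivity.Theorems.AnisotropyChordTransferFibre3L2TCell

/-!
# Route `AnisotropyChord` / H0 rotor rung, LEVEL 2 row `N₁`, t-BLOCK `96 ≤ L ≤ 127`: the block cell of the column
# `ν ∈ [0.022592, 0.023044]` and its twelve kernel certificates

The `L2.TCell` (`…Fibre3L2TCell`) of the `ν`-column `[22592, 23044]/10⁶` for the t-block `L ∈ [96, 127]` of the range
`48 ≤ L < 128` (route-lead ruling R1): t-slot `[122383/50000000, 428371/100000000]` (`⌊(2·piLo/127)²⌋`, `⌈(2·piHi/96)²⌉` to `10⁻⁸`),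
`T = 429/10⁵ ≥ θ₀²`, window `K = 24`, and the twelve brackets of the normalised named sums
(`θ⁴S₂ ∈ [6.23864, 6.29247]`, …, `θ⁴Tx(1,1) ∈ [4.17075, 4.29016]`;
exact mirror `b1certG.py` of `B1.cellCheck 96` / `B1.txCellCheckG 96`), ★ `tcB096N22592_check` by one kernel `decide`.  The cell
files `…N1RowTa/TbB096N22592C….lean` of this column import it.
Prover seat `hubbard-h0-rotor-p2` g8; helper for piece A = stmt-HubbardSuperconductivity-23918 of rung 19089
(`--supports`, helper class).  Nothing here proves superconductivity in the Hubbard model; one kernel-certified piece of ONE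
conditional reduction (the GM₃ ∀L certificate, Level-2 row `N₁`, t-blocks `48 ≤ L < 128`, route-lead ruling R1); the rotor
TARGET as originally worded stays FALSE (g15 verdict).  Mathlib + the tree only; no sorry.  Generated by p2 g8's
scratch/tcells/mkcellT.py (copy in HOME/hubbard-h0-rotor-p2/scratch-g8/).
-/

set_option linter.dupNamespace false
set_option autoImplicit false

namespace Summit.HubbardSuperconductivity.HubbardSuperconductivity.Theorems.AnisotropyChord.Transfer.Fibre3.L2.N1

open Summit.HubbardSuperconductivity.HubbardSuperconductivity.Theorems.AnisotropyChord.Transfer.Fibre3.L2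

/-- the block cell of the column `ν ∈ [22592, 23044]/10⁶`, block `96 ≤ L ≤ 127`. -/
def tcB096N22592 : L2.TCell :=
  { L0 := 96,
    L1 := 127,
    tlo := 122383/50000000,
    thi := 428371/100000000,
    n1 := 22592,
    n2 := 23044,
    νd := 1000000,
    Tn := 429,
    Td := 100000,
    D := 1000000,
    bS2 := (1559659/250000, 98319827/15625000),
    bS3 := (1240483/250000, 4976947117/1000000000),
    bS4 := (1169111/250000, 2347104259/500000000),
    bT10 := (1899751/500000, 385591011/100000000),
    bT11 := (10581/2500, 429015611/100000000),
    bG21 := (2160041/1000000, 2168201363/1000000000),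
    bG12 := (2160041/1000000, 2168201363/1000000000),
    bG22 := (19719/15625, 1268334861/1000000000),
    bG31 := (428179/250000, 1720608861/1000000000),
    bG13 := (428179/250000, 1720608861/1000000000),
    bTx10 := (373735189/100000000, 385591011/100000000),
    bTx11 := (417075389/100000000, 429015611/100000000) }

/-- ★ the twelve kernel certificates (and the t-slot scales) of the column hold. -/
theorem tcB096N22592_check : tcB096N22592.check = true := by decide +kernel

end Summit.HubbardSuperconductivity.HubbardSuperconductivity.Theorems.AnisotropyChord.Transfer.Fibre3.L2.N1
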